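import Mathlib
import Summits.CriticalPhenomena.CardyFormulaZ2.Theorems.CardyFlipRussoSquareFromVoronoiHubDefs
import Summits.CriticalPhenomena.CardyFormulaZ2.Theorems.CardyFlipRussoSquareFromVoronoiHubFaithfulPart2
import Summits.CriticalPhenomena.CardyFormulaZ2.Theorems.CardyFlipRussoSquareFromVoronoiHubFaithfulPart4
import Summits.CriticalPhenomena.CardyFormulaZ2.Theorems.CardyFlipRussoSquareFromVoronoiHubFaithfulPart5
import Summits.CriticalPhenomena.CardyFormulaZ2.Theorems.CardyFlipRussoSquareFromVoronoiHubFaithfulPart6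
import Summits.CriticalPhenomena.CardyFormulaZ2.Theorems.CardyFlipRussoSquareFromVoronoiHubFaithfulPart7
import Summits.CriticalPhenomena.CardyFormulaZ2.Theorems.CardyFlipRussoSquareFromVoronoiHubFaithfulPart8
import Summits.CriticalPhenomena.CardyFormulaZ2.Theorems.CardyFlipRussoSquareFromVoronoiHubSandwichPart1
import Literature.Probability.Percolation.VoronoiCrossing
import Literature.Probability.Percolation.SitePaths
import HarnessLib

/-!
# Stub `stub_blockChain` of line `Sketch` (r2 k4, card `poissonised-chessboard`), crux `SquareFromVoronoiHub`

The block chain lemma (S3) of the chessboard endpoint of the crux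
`Summit.CriticalPhenomena.CardyFormulaZ2.Theses.CardyFlipRusso.SquareFromVoronoiHub`
(stmt-CriticalPhenomena-6434, route `CardyFlipRusso`; lead c4 skeleton
`Cruxes/SquareFromVoronoiHub/Lines/Sketch.lean`).

**Content.**  The plane is partitioned into blocks by an abstract block map
`β : ℂ → (ℤ × ℤ) ⊕ (ℤ × ℤ)` (block index = a vertex of the centred square lattice `G_s`, `zGs v`
its centre) at mesh `δ`, with two axioms: (rad) every point `p` is within `3δ/5` of the centre
`δ • zGs (β p)` of its block; (sep) two points at distance `≤ δ/4` have equal or `G_s`-adjacent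
blocks.  Nuclei `K ⊆ ℂ`; the coin set `ω₂` colours a nucleus `p` black iff `β p ∈ ω₂`.  Density:
every point of `V` has a nucleus within `δ/16`.  `stub_blockChain`: a continuous path piece
`t ↦ γ.extend t`, `t ∈ [a, b]`, staying in `V` and in the black region
(`blackRegion B W = {z | infDist z B ≤ infDist z W}`), is shadowed by a `G_s`-path of BLACK
blocks all within `7δ/10` of the piece, from a block within `7δ/10` of `γ.extend a` to one
within `7δ/10` of `γ.extend b`.

**Proof.**  Deterministic and elementary (Bollobás–Riordan, *Percolation* (2006), Ch. 7, proof
of Thm. 2, p. 199, "a connected black set contains a lattice path", in its chessboard form):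
(1) every point of the piece has a BLACK nucleus within `δ/16` (its nearest nucleus is within
`δ/16`; if that one is white, blackness of the point and `Metric.infDist_lt_iff` give a black one
at least as close), whose block is black and within `δ/16 + 3δ/5 < 7δ/10` of the point;
(2) `γ.extend` is uniformly continuous on the compact `[a, b]`
(`IsCompact.uniformContinuousOn_of_continuous`), with modulus `η` for `δ/8`;
(3) subdivide `[a, b]` into `N` steps of length `< η`; consecutive chosen nuclei are within
`δ/16 + δ/8 + δ/16 = δ/4`, so (sep) makes their blocks equal or adjacent and the `PathIn` chain
(`Literature/Probability/Percolation/SitePaths.lean`) extends step by step (`Nat.rec`).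

Sources: Bollobás–Riordan 2006, Ch. 7 (proof of Thm. 2) and Ch. 8 §8.1 (black region);
Mathlib: `Metric.infDist_lt_iff`, `Metric.uniformContinuousOn_iff`, `Path.continuous_extend`.
-/

noncomputable section

open scoped Topology
open Filter Set MeasureTheory Metric
open Literature.Analysis.FunctionSpaces (PointConfig IsPoissonPointProcess)
open Literature.Probability.RandomPlanarGeometry (ConformalRectangle cardyFunction crossRatio)
open Literature.Probability.Percolation (SiteConfig sitePercolation half voronoiCrossing blackRegion PathIn)
open Summit.CriticalPhenomena.CardyFormulaZ2.Cruxes.SquareFromVoronoiHub.VoronoiBlocks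
  (zGs Gs crudeCrossing siteCrossingProb voronoiCrossingProb squareFromVoronoiHub_iff)
open Summit.CriticalPhenomena.CardyFormulaZ2.Cruxes.SquareFromVoronoiHub.VoronoiBlocks.Faithful

namespace Summit.CriticalPhenomena.CardyFormulaZ2.Cruxes.SquareFromVoronoiHub.PoissonisedChessboard

/-- **The block chain lemma** (S3, registered).  For an abstract block map `β` at mesh `δ`
with (rad) `dist p (δ • zGs (β p)) ≤ 3δ/5` and (sep) `dist p q ≤ δ/4 → β p = β q ∨ β p ∼ β q`,
nuclei `K` that are `δ/16`-dense near `V`, at least one black nucleus, and a path piece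
`γ.extend '' [a, b]` inside `V` and inside the black region of the colouring "`p` black iff
`β p ∈ ω₂`": there is a `G_s`-path of black blocks, all within `7δ/10` of the piece, from a block
within `7δ/10` of `γ.extend a` to a block within `7δ/10` of `γ.extend b`.
[cite: BollobasRiordan2006, Ch. 7 proof of Thm. 2 p. 199] -/
theorem stub_blockChain : ∀ {δ : ℝ}, 0 < δ → ∀ (β : ℂ → (ℤ × ℤ) ⊕ (ℤ × ℤ)),
      (∀ p : ℂ, dist p ((δ : ℂ) * zGs (β p)) ≤ 3 / 5 * δ) →
      (∀ p q : ℂ, dist p q ≤ δ / 4 → β p = β q ∨ Gs.Adj (β p) (β q)) →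
      ∀ (ω₂ : Set ((ℤ × ℤ) ⊕ (ℤ × ℤ))) (K V : Set ℂ),
      (∀ z ∈ V, ∃ p ∈ K, dist z p < δ / 16) → {p | p ∈ K ∧ β p ∈ ω₂}.Nonempty →
      ∀ {x y : ℂ} (γ : Path x y) (a b : ℝ), 0 ≤ a → a ≤ b → b ≤ 1 →
      (∀ t ∈ Icc a b, γ.extend t ∈ V) →
      (∀ t ∈ Icc a b, γ.extend t ∈ blackRegion {p | p ∈ K ∧ β p ∈ ω₂} {p | p ∈ K ∧ β p ∉ ω₂}) →
      ∃ u w : (ℤ × ℤ) ⊕ (ℤ × ℤ), dist (γ.extend a) ((δ : ℂ) * zGs u) ≤ 7 / 10 * δ ∧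
        dist (γ.extend b) ((δ : ℂ) * zGs w) ≤ 7 / 10 * δ ∧
        PathIn Gs ({v | ∃ t ∈ Icc a b, dist (γ.extend t) ((δ : ℂ) * zGs v) ≤ 7 / 10 * δ} ∩ ω₂) u w := by
  intro δ hδ β hrad hsep ω₂ K V hKV hBne x y γ a b _ hab _ hV hblack
  -- (1) pointwise: a black nucleus within `δ/16` of every point of the piece
  have hpt : ∀ t : ℝ, ∃ q : ℂ, t ∈ Icc a b → q ∈ K ∧ β q ∈ ω₂ ∧ dist (γ.extend t) q < δ / 16 := by
    intro t
    by_cases ht : t ∈ Icc a b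
    · obtain ⟨p, hpK, hp⟩ := hKV _ (hV t ht)
      by_cases hpω : β p ∈ ω₂
      · exact ⟨p, fun _ => ⟨hpK, hpω, hp⟩⟩
      · have hW : infDist (γ.extend t) {p | p ∈ K ∧ β p ∉ ω₂} ≤ dist (γ.extend t) p :=
          infDist_le_dist_of_mem ⟨hpK, hpω⟩
        have hlt : infDist (γ.extend t) {p | p ∈ K ∧ β p ∈ ω₂} < δ / 16 :=
          lt_of_le_of_lt ((hblack t ht).trans hW) hp
        obtain ⟨q, hqB, hq⟩ := (infDist_lt_iff hBne).1 hlt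
        exact ⟨q, fun _ => ⟨hqB.1, hqB.2, hq⟩⟩
    · exact ⟨0, fun h => absurd h ht⟩
  choose f hf using hpt
  -- the block of the chosen nucleus is black and within `7δ/10` of the point
  have hfA : ∀ t ∈ Icc a b, dist (γ.extend t) ((δ : ℂ) * zGs (β (f t))) ≤ 7 / 10 * δ := by
    intro t ht
    have hd := (hf t ht).2.2
    calc dist (γ.extend t) ((δ : ℂ) * zGs (β (f t)))
        ≤ dist (γ.extend t) (f t) + dist (f t) ((δ : ℂ) * zGs (β (f t))) := dist_triangle _ _ _
      _ ≤ δ / 16 + 3 / 5 * δ := add_le_add hd.le (hrad _)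
      _ ≤ 7 / 10 * δ := by linarith
  have hmemA : ∀ t ∈ Icc a b, β (f t) ∈
      {v | ∃ t ∈ Icc a b, dist (γ.extend t) ((δ : ℂ) * zGs v) ≤ 7 / 10 * δ} ∩ ω₂ :=
    fun t ht => ⟨⟨t, ht, hfA t ht⟩, (hf t ht).2.1⟩
  -- (2) uniform continuity of `γ.extend` on `[a, b]`, modulus `η` for `δ/8`
  obtain ⟨η, hη, hηuc⟩ := Metric.uniformContinuousOn_iff.1
    (isCompact_Icc.uniformContinuousOn_of_continuous
      (γ.continuous_extend.continuousOn (s := Icc a b))) (δ / 8) (by positivity)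
  -- one step: `η`-close parameters give equal or adjacent blocks
  have hstep : ∀ s ∈ Icc a b, ∀ s' ∈ Icc a b, dist s s' < η →
      β (f s) = β (f s') ∨ Gs.Adj (β (f s)) (β (f s')) := by
    intro s hs s' hs' hss'
    refine hsep _ _ ?_
    have h1 : dist (f s) (γ.extend s) < δ / 16 := by rw [dist_comm]; exact (hf s hs).2.2
    have h2 := (hf s' hs').2.2
    have h3 := hηuc s hs s' hs' hss'
    calc dist (f s) (f s')
        ≤ dist (f s) (γ.extend s) + dist (γ.extend s) (γ.extend s') + dist (γ.extend s') (f s') :=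
          dist_triangle4 _ _ _ _
      _ ≤ δ / 4 := by linarith
  -- (3) the subdivision of `[a, b]` into `N` steps of length `< η`
  obtain ⟨N, hN⟩ := exists_nat_gt ((b - a) / η)
  have hN0 : (0 : ℝ) < N := lt_of_le_of_lt (div_nonneg (sub_nonneg.2 hab) hη.le) hN
  have hq0 : 0 ≤ (b - a) / N := div_nonneg (sub_nonneg.2 hab) hN0.le
  have hqη : (b - a) / N < η := by
    rw [div_lt_iff₀ hN0]
    have := (div_lt_iff₀ hη).1 hN
    linarith [mul_comm (N : ℝ) η]
  obtain ⟨tt, htt⟩ : ∃ tt : ℕ → ℝ, ∀ i, tt i = a + i * ((b - a) / N) := ⟨_, fun _ => rfl⟩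
  have htt_mem : ∀ i : ℕ, i ≤ N → tt i ∈ Icc a b := by
    intro i hi
    have hi' : (i : ℝ) ≤ N := by exact_mod_cast hi
    have h1 : (i : ℝ) * ((b - a) / N) ≤ N * ((b - a) / N) := mul_le_mul_of_nonneg_right hi' hq0
    rw [mul_div_cancel₀ _ hN0.ne'] at h1
    rw [htt]
    exact ⟨le_add_of_nonneg_right (mul_nonneg i.cast_nonneg hq0), by linarith⟩
  have htt_dist : ∀ i : ℕ, dist (tt i) (tt (i + 1)) < η := by
    intro i
    rw [Real.dist_eq, htt, htt, Nat.cast_succ,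
      show a + i * ((b - a) / N) - (a + (i + 1) * ((b - a) / N)) = -((b - a) / N) by ring,
      abs_neg, abs_of_nonneg hq0]
    exact hqη
  -- the chain of black blocks along the subdivision, by induction
  have hchain : ∀ n : ℕ, n ≤ N → PathIn Gs
      ({v | ∃ t ∈ Icc a b, dist (γ.extend t) ((δ : ℂ) * zGs v) ≤ 7 / 10 * δ} ∩ ω₂)
      (β (f (tt 0))) (β (f (tt n))) := by
    intro n
    induction n with
    | zero => exact fun h => PathIn.refl (hmemA _ (htt_mem 0 h))
    | succ n ih =>
      intro hn
      have hn' : n ≤ N := Nat.le_of_succ_le hn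
      exact (ih hn').trans (PathIn.of_eq_or_adj (hmemA _ (htt_mem n hn')) (hmemA _ (htt_mem _ hn))
        (hstep _ (htt_mem n hn') _ (htt_mem _ hn) (htt_dist n)))
  -- (4) endpoints: `tt 0 = a`, `tt N = b`
  have htt0 : tt 0 = a := by rw [htt, Nat.cast_zero, zero_mul, add_zero]
  have httN : tt N = b := by rw [htt, mul_div_cancel₀ _ hN0.ne']; ring
  have hc := hchain N le_rfl
  rw [htt0, httN] at hc
  exact ⟨β (f a), β (f b), hfA a ⟨le_rfl, hab⟩, hfA b ⟨hab, le_rfl⟩, hc⟩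

end Summit.CriticalPhenomena.CardyFormulaZ2.Cruxes.SquareFromVoronoiHub.PoissonisedChessboard

end
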